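import Literature.Barriers.CriticalPhenomena.RigorousRGSmallParameterTorusBump
import Literature.Barriers.CriticalPhenomena.RigorousRGSmallParameterLocalMonomials
import Literature.Barriers.CriticalPhenomena.RigorousRGSmallParameterLatticeLeibniz
import HarnessLib

/-!
# `RigorousRGSmallParameter` (Slade, Theorem 1.4.1): the lattice cutoff — coordinate products
# `χ₁(x) = ∏_j b_j(x_j)`, slot products `χ(z) = ∏_k χ₁(z_k)`, factorisation of finite differences
# and `|∇^β χ_z| ≤ ρ^{|β|}` ([BS-rg-loc] §3.3, cutoff `χ_t` of Lemma 3.3.1)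

Companion ("proof architecture") file of
`Literature/Barriers/CriticalPhenomena/RigorousRGSmallParameter.lean` (Loc norm-estimates layer,
[BS-rg-loc] §3.3). In the proof of Lemma 3.3.1, "`χ_t`" is "a function of `p` variables, which
takes the value `1` if each variable lies in `X`, and the value `0` if any variable lies in
`ℤ^d ∖ X_{2t}`", and its lattice derivatives are bounded by `(c₀t^{-1}R^{-1})^{|β|}` per difference.
This file PROVES the structural facts making such bounds multiplicative: finite differences along
unit steps of a product over coordinates act coordinatewise (`fdiffs_coordProd`), a difference
programme on a product over the slots of a sequence acts slotwise (`napply_slotProd`), and hence a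
cutoff assembled from one-dimensional bumps `b_j` with `|D_l b_j| ≤ ρ^{|l|}` (`…TorusBump`)
satisfies `|∇^β χ_z| ≤ ρ^{|β|}` for every programme with at most `K` differences per slot
(`abs_napply_slotProd_le`). All PROVED, 0 sorry:

* Part B (coordinates): `dirsAt`, `dirsAt_cons`, `sum_length_dirsAt`, `coordProd`,
  **`fdiffs_coordProd`**, **`abs_fdiffs_coordProd_le`**;
* Part C (slots): `slotProd`, `update_succ`, **`diffOp_slotProd`**, `progAt`, `progAt_cons`,
  `length_progAt` (`= countAt`), **`napply_slotProd`**, `napply_eq_zero_of_le_slot`,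
  `abs_slotProd_le`, `sum_countAt_eq_length`, **`abs_napply_slotProd_le`**.

Sources: D. C. Brydges, G. Slade, *A renormalisation group method. II. Approximation by local
polynomials*, J. Stat. Phys. 159 (2015) 461–491, arXiv:1403.7253, §3.3 (proof of Lemma 3.3.1),
TeX-source numbering; the lattice product rules are folklore.

## References

* [BrydgesSlade2015RGII] D. C. Brydges, G. Slade, *A renormalisation group method. II.
  Approximation by local polynomials*, J. Stat. Phys. **159** (2015) 461–491, arXiv:1403.7253.
-/

noncomputable section

namespace Literature.Barriers.CriticalPhenomena

namespace LongRangePhi4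

namespace Loc

open Finset Tphi RGNorm LocalPoly Bump Literature.Probability.LatticeModels

variable {d M n : ℕ}

/-! ### Part B: products over coordinates -/

/-- The directions of a step list falling on coordinate `j` (in order). [folklore] -/
def dirsAt (j : Fin d) (L : List (Fin d × Bool)) : List Bool := (L.filter fun s => s.1 = j).map Prod.snd

/-- No steps, no directions. [folklore] -/
@[simp] theorem dirsAt_nil (j : Fin d) : dirsAt j ([] : List (Fin d × Bool)) = [] := rfl

/-- `dirsAt` on a cons. [folklore] -/
theorem dirsAt_cons (j : Fin d) (s : Fin d × Bool) (L : List (Fin d × Bool)) :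
    dirsAt j (s :: L) = if s.1 = j then s.2 :: dirsAt j L else dirsAt j L := by
  unfold dirsAt
  rw [List.filter_cons]
  by_cases h : s.1 = j <;> simp [h]

/-- `Σ_j |dirsAt j L| = |L|`. [folklore] -/
theorem sum_length_dirsAt (L : List (Fin d × Bool)) : ∑ j, (dirsAt j L).length = L.length := by
  induction L with
  | nil => simp
  | cons s L ih =>
      simp only [dirsAt_cons, List.length_cons]
      rw [show (fun j => (if s.1 = j then s.2 :: dirsAt j L else dirsAt j L).length) =
          fun j => (dirsAt j L).length + if s.1 = j then 1 else 0 from funext fun j => by split_ifs <;> simp,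
        Finset.sum_add_distrib, ih, Finset.sum_ite_eq]
      simp

/-- The product of one-coordinate functions `χ₁(x) = ∏_j b_j(x_j)`. [folklore] -/
def coordProd (b : Fin d → ZMod M → ℝ) : TorusSite d M → ℝ := fun x => ∏ j, b j (x j)

/-- **Differences of a coordinate product factorise over the coordinates**:
`∇^L(∏_j b_j(x_j)) = ∏_j (D_{dirsAt j L} b_j)(x_j)`. [folklore] -/
theorem fdiffs_coordProd (b : Fin d → ZMod M → ℝ) : ∀ L : List (Fin d × Bool),
    fdiffs (L.map (unitStep d M)) (coordProd b) = coordProd fun j => dirDiffs (dirsAt j L) (b j)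
  | [] => by simp [dirDiffs]
  | s :: L => by
      rw [List.map_cons, fdiffs_cons, fdiffs_coordProd b L]
      funext x
      set b' : Fin d → ZMod M → ℝ := fun j => dirDiffs (dirsAt j L) (b j) with hb'
      have hstep : ∀ j, (x + unitStep d M s) j = x j + (if j = s.1 then (if s.2 then 1 else -1) else 0) := by
        intro j
        simp only [unitStep, Pi.add_apply, Pi.single_apply]
      -- split off the factor `s.1`
      have hL : coordProd b' (x + unitStep d M s) =
          b' s.1 (x s.1 + (if s.2 then 1 else -1)) * ∏ j ∈ univ.erase s.1, b' j (x j) := by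
        unfold coordProd
        rw [← Finset.mul_prod_erase _ _ (Finset.mem_univ s.1)]
        congr 1
        · rw [hstep, if_pos rfl]
        · refine Finset.prod_congr rfl fun j hj => ?_
          rw [hstep, if_neg (Finset.ne_of_mem_erase hj), add_zero]
      have hR : coordProd b' x = b' s.1 (x s.1) * ∏ j ∈ univ.erase s.1, b' j (x j) := by
        unfold coordProd
        rw [← Finset.mul_prod_erase _ _ (Finset.mem_univ s.1)]
      have hN : coordProd (fun j => dirDiffs (dirsAt j (s :: L)) (b j)) x =
          dirDiff s.2 (b' s.1) (x s.1) * ∏ j ∈ univ.erase s.1, b' j (x j) := by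
        unfold coordProd
        rw [← Finset.mul_prod_erase _ _ (Finset.mem_univ s.1)]
        congr 1
        · show dirDiffs (dirsAt s.1 (s :: L)) (b s.1) (x s.1) = _
          rw [dirsAt_cons, if_pos rfl]; rfl
        · refine Finset.prod_congr rfl fun j hj => ?_
          show dirDiffs (dirsAt j (s :: L)) (b j) (x j) = b' j (x j)
          rw [dirsAt_cons, if_neg (Finset.ne_of_mem_erase hj).symm]
      rw [hL, hR, hN]
      simp only [dirDiff]
      ring

/-- **`|∇^L χ₁| ≤ ρ^{|L|}`** when every coordinate factor obeys `|D_l b_j| ≤ ρ^{|l|}` for `|l| ≤ K` and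
at most `K` steps fall on each coordinate. [folklore] -/
theorem abs_fdiffs_coordProd_le {b : Fin d → ZMod M → ℝ} {ρ : ℝ} {K : ℕ}
    (hb : ∀ j (l : List Bool) y, l.length ≤ K → |dirDiffs l (b j) y| ≤ ρ ^ l.length)
    (L : List (Fin d × Bool)) (hK : ∀ j, (dirsAt j L).length ≤ K) (x : TorusSite d M) :
    |fdiffs (L.map (unitStep d M)) (coordProd b) x| ≤ ρ ^ L.length := by
  rw [fdiffs_coordProd]
  unfold coordProd
  rw [Finset.abs_prod, ← sum_length_dirsAt L, ← Finset.prod_pow_eq_pow_sum]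
  exact Finset.prod_le_prod (fun j _ => abs_nonneg _) fun j _ => hb j _ _ (hK j)

/-! ### Part C: products over the slots of a sequence -/

/-- The slot product `∏_k F_k(z_k)` of one-point functions indexed by the slot. [folklore] -/
def slotProd : (ℕ → TorusSite d M → ℝ) → List (TorusSite d M × Fin n) → ℝ
  | _, [] => 1
  | F, q :: z => F 0 q.1 * slotProd (fun k => F (k + 1)) z

/-- The empty slot product. [folklore] -/
@[simp] theorem slotProd_nil (F : ℕ → TorusSite d M → ℝ) : slotProd (n := n) F [] = 1 := rfl

/-- The slot product on a cons. [folklore] -/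
theorem slotProd_cons (F : ℕ → TorusSite d M → ℝ) (q : TorusSite d M × Fin n) (z : List (TorusSite d M × Fin n)) :
    slotProd F (q :: z) = F 0 q.1 * slotProd (fun k => F (k + 1)) z := rfl

/-- Shifting the successor-indexed family. [folklore] -/
theorem update_succ (F : ℕ → TorusSite d M → ℝ) (k : ℕ) (G : TorusSite d M → ℝ) :
    (fun k' => Function.update F (k + 1) G (k' + 1)) = Function.update (fun k' => F (k' + 1)) k G := by
  funext k'
  by_cases h : k' = k
  · subst h; simp
  · rw [Function.update_of_ne (by omega), Function.update_of_ne h]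

/-- **One difference on a slot product** acts on the factor of that slot. [folklore] -/
theorem diffOp_slotProd (s : TorusSite d M) : ∀ (z : List (TorusSite d M × Fin n)) (k : ℕ) (F : ℕ → TorusSite d M → ℝ),
    k < z.length → diffOp k s (slotProd F) z = slotProd (Function.update F k (fun x => F k (x + s) - F k x)) z
  | [], k, F, h => by simp at h
  | q :: z, 0, F, _ => by
      simp only [diffOp, shiftAt, List.modify_zero_cons, slotProd_cons, Function.update_self]
      rw [show (fun k => Function.update F 0 (fun x => F 0 (x + s) - F 0 x) (k + 1)) = fun k => F (k + 1) from
        funext fun k => Function.update_of_ne (by omega) _ _]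
      ring
  | q :: z, k + 1, F, h => by
      have ih := diffOp_slotProd s z k (fun k' => F (k' + 1)) (by simpa using h)
      simp only [diffOp, shiftAt, List.modify_succ_cons, slotProd_cons] at ih ⊢
      rw [Function.update_of_ne (by omega), update_succ, ← ih]
      ring

/-- The accumulated one-point operator of a programme at slot `k`. [folklore] -/
def progAt (k : ℕ) (β : List (ℕ × (Fin d × Bool))) : List (Fin d × Bool) := (β.filter fun q => q.1 = k).map Prod.snd

/-- `progAt` on a cons. [folklore] -/
theorem progAt_cons (k : ℕ) (q : ℕ × (Fin d × Bool)) (β : List (ℕ × (Fin d × Bool))) :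
    progAt k (q :: β) = if q.1 = k then q.2 :: progAt k β else progAt k β := by
  unfold progAt; rw [List.filter_cons]; by_cases h : q.1 = k <;> simp [h]

/-- `|progAt k β| = countAt k β`. [folklore] -/
theorem length_progAt (k : ℕ) (β : List (ℕ × (Fin d × Bool))) : (progAt k β).length = countAt k β := by
  induction β with
  | nil => simp [progAt, countAt]
  | cons q β ih =>
      rw [progAt_cons]
      unfold countAt at ih ⊢
      simp only [List.map_cons, List.count_cons]
      by_cases h : q.1 = k
      · simp [h, ih]
      · rw [if_neg h]; simp [h, ih]

/-- **A programme on a slot product** acts slotwise: `∇^β(∏_k F_k(z_k)) = ∏_k (∇^{progAt k β}F_k)(z_k)`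
(all slots of `β` below `|z|`). [folklore] -/
theorem napply_slotProd (F : ℕ → TorusSite d M → ℝ) : ∀ (β : List (ℕ × (Fin d × Bool))) (z : List (TorusSite d M × Fin n)),
    (∀ q ∈ β, q.1 < z.length) →
      napply (unitStep d M) β (slotProd F) z = slotProd (fun k => fdiffs ((progAt k β).map (unitStep d M)) (F k)) z
  | [], z, _ => by simp [progAt]
  | q :: β, z, h => by
      rw [napply_cons]
      simp only [diffOp]
      have hβ : ∀ q' ∈ β, q'.1 < z.length := fun q' hq' => h q' (List.mem_cons_of_mem _ hq')
      rw [napply_slotProd F β _ (by simpa using hβ), napply_slotProd F β z hβ]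
      have hq : q.1 < z.length := h q (by simp)
      have e := diffOp_slotProd (n := n) (unitStep d M q.2) z q.1 (fun k => fdiffs ((progAt k β).map (unitStep d M)) (F k)) hq
      simp only [diffOp] at e
      rw [e]
      congr 1
      funext k
      by_cases hk : k = q.1
      · subst hk
        rw [Function.update_self, progAt_cons, if_pos rfl, List.map_cons, fdiffs_cons]
      · rw [Function.update_of_ne hk, progAt_cons, if_neg (Ne.symm hk)]

/-- A programme touching a slot beyond the sequence kills it. [folklore] -/
theorem napply_eq_zero_of_le_slot (g : List (TorusSite d M × Fin n) → ℝ) :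
    ∀ (β : List (ℕ × (Fin d × Bool))) (z : List (TorusSite d M × Fin n)), (∃ q ∈ β, z.length ≤ q.1) →
      napply (unitStep d M) β g z = 0
  | [], z, h => by simp at h
  | q :: β, z, h => by
      rw [napply_cons]
      simp only [diffOp]
      by_cases hq : z.length ≤ q.1
      · have : shiftAt q.1 (unitStep d M q.2) z = z := by
          unfold shiftAt
          exact List.modify_eq_self hq
        rw [this, sub_self]
      · obtain ⟨q', hq', h'⟩ := h
        rcases List.mem_cons.1 hq' with rfl | hmem
        · exact absurd h' hq
        · rw [napply_eq_zero_of_le_slot g β _ ⟨q', hmem, by simpa using h'⟩,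
            napply_eq_zero_of_le_slot g β z ⟨q', hmem, h'⟩, sub_self]

/-- **Bound for slot products**: `|∏_k G_k(z_k)| ≤ ∏_{k<|z|} g_k`. [folklore] -/
theorem abs_slotProd_le : ∀ (G : ℕ → TorusSite d M → ℝ) (g : ℕ → ℝ) (z : List (TorusSite d M × Fin n)),
    (∀ k x, |G k x| ≤ g k) → |slotProd G z| ≤ ∏ k ∈ range z.length, g k
  | G, g, [], _ => by simp
  | G, g, q :: z, h => by
      rw [slotProd_cons, abs_mul, List.length_cons, Finset.prod_range_succ', ]
      rw [mul_comm]
      refine mul_le_mul (abs_slotProd_le _ (fun k => g (k + 1)) z fun k x => h (k + 1) x) (h 0 _) (abs_nonneg _) ?_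
      exact Finset.prod_nonneg fun k _ => (abs_nonneg _).trans (h (k + 1) (q.1))

/-- `Σ_{k<|z|} countAt k β = |β|` when all slots of `β` are below `|z|`. [folklore] -/
theorem sum_countAt_eq_length (β : List (ℕ × (Fin d × Bool))) (r : ℕ) (h : ∀ q ∈ β, q.1 < r) :
    ∑ k ∈ range r, countAt k β = β.length := by
  induction β with
  | nil => simp [countAt]
  | cons q β ih =>
      have h' : ∀ q' ∈ β, q'.1 < r := fun q' hq' => h q' (List.mem_cons_of_mem _ hq')
      unfold countAt at ih ⊢
      simp only [List.map_cons, List.count_cons, beq_iff_eq, Finset.sum_add_distrib, ih h', List.length_cons]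
      congr 1
      rw [Finset.sum_ite_eq (range r) q.1 (fun _ => 1), if_pos (Finset.mem_range.2 (h q (by simp)))]

/-- **`|∇^β χ_z| ≤ ρ^{|β|}`** for the slot product `χ = ∏_k χ₁(z_k)` of a one-point function with
`|∇^L χ₁| ≤ ρ^{|L|}` whenever at most `K` steps fall on each coordinate, for every programme `β`
with at most `K` differences per slot. [folklore] -/
theorem abs_napply_slotProd_le {χ₁ : TorusSite d M → ℝ} {ρ : ℝ} (hρ : 0 ≤ ρ) {K : ℕ}
    (hχ : ∀ (L : List (Fin d × Bool)) x, (∀ j, (dirsAt j L).length ≤ K) → |fdiffs (L.map (unitStep d M)) χ₁ x| ≤ ρ ^ L.length)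
    (β : List (ℕ × (Fin d × Bool))) (hK : ∀ k, countAt k β ≤ K) (z : List (TorusSite d M × Fin n)) :
    |napply (unitStep d M) β (slotProd fun _ => χ₁) z| ≤ ρ ^ β.length := by
  by_cases hz : ∀ q ∈ β, q.1 < z.length
  · rw [napply_slotProd _ β z hz]
    have hdirs : ∀ k j, (dirsAt j (progAt k β)).length ≤ K := by
      intro k j
      refine le_trans ?_ (hK k)
      rw [← length_progAt]
      unfold dirsAt
      exact (List.length_map _).le.trans (List.length_filter_le _ _)
    refine (abs_slotProd_le _ (fun k => ρ ^ (progAt k β).length) z fun k x => ?_).trans ?_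
    · simpa using hχ (progAt k β) x (hdirs k)
    · rw [Finset.prod_pow_eq_pow_sum]
      simp only [length_progAt]
      rw [sum_countAt_eq_length β z.length hz]
  · push Not at hz
    obtain ⟨q, hq, h⟩ := hz
    rw [napply_eq_zero_of_le_slot _ β z ⟨q, hq, h⟩, abs_zero]
    positivity

end Loc

end LongRangePhi4

end Literature.Barriers.CriticalPhenomena
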